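import Mathlib.Analysis.ODE.Gronwall
import Mathlib.Analysis.Calculus.MeanValue
import Literature.Geometry.Lorentzian.Basic
import HarnessLib

/-!
# Crux `GapExhaustion` (stmt-FinalStateConjecture-10808), line `photon-shell-pseudoconvexity`:
# stub (K-B) `stub_firstOrderVanishing` — a first-order dominated map vanishing at a point vanishes

Route `BartnikGapSettling`; helper (`--supports stmt-FinalStateConjecture-10808`) landing the
registered sub-stub (K-B) of wave 2 of line lead c8 (LOCAL unique continuation of coordinate
Killing fields from a `1`-jet, the patching tool of the Ionescu–Klainerman sweeps S3/S5/S6b):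
the generic analytic half of "a Killing field vanishing to first order at a point of a connected
open set vanishes identically". **If `F : E4 → W` is differentiable on an open connected set `V`,
its derivative is pointwise dominated by a continuous multiple of its value,
`‖DF(x)‖ ≤ c(x) ‖F(x)‖` on `V`, and `F` vanishes at one point `x₀ ∈ V`, then `F = 0` on `V`.**

Proof (Grönwall along segments + open–closed argument): the zero set `Z = {x ∈ V | F x = 0}` is
open — near a zero `x ∈ V` one has `c ≤ c x + 1` on a ball `B ⊆ V`, and for `y ∈ B` the
composite `g t = F (x + t • (y - x))` along the segment (which stays in `B`) satisfies
`‖g' t‖ ≤ (c x + 1) ‖y - x‖ ‖g t‖` and `g 0 = 0`, so Grönwall with zero initial value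
(`eq_zero_of_abs_deriv_le_mul_abs_self_of_eq_zero_right`) gives `g 1 = F y = 0`; the complement
`V ∩ F⁻¹' {0}ᶜ` is open by continuity of `F` on the open `V`; connectedness of `V`
(`IsPreconnected.subset_left_of_subset_union`) and `x₀ ∈ Z` give `V ⊆ Z`.
-/

noncomputable section

-- D-0017: single-problem summit, `Summit.<S>.<S>.…` by design (cf. lakefile `weak.linter.dupNamespace`).
set_option linter.dupNamespace false

namespace Summit.FinalStateConjecture.FinalStateConjecture.Theorems

open Set Filter Literature.Geometry.Lorentzian
open scoped Topology

/-- Grönwall along segments: if `F` is differentiable on an open set `V` of a real normed space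
with `‖DF‖ ≤ c ‖F‖` on `V` for a `c` continuous on `V`, and `F x = 0` at some `x ∈ V`, then `F`
vanishes on a ball around `x` contained in `V`. [folklore] -/
private theorem firstOrderVanishing_ball {X W : Type*} [NormedAddCommGroup X] [NormedSpace ℝ X]
    [NormedAddCommGroup W] [NormedSpace ℝ W] {V : Set X} {F : X → W} {c : X → ℝ}
    (hV : IsOpen V) (hF : DifferentiableOn ℝ F V) (hc : ContinuousOn c V)
    (hb : ∀ x ∈ V, ‖fderiv ℝ F x‖ ≤ c x * ‖F x‖) {x : X} (hx : x ∈ V) (hx0 : F x = 0) :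
    ∃ r > 0, ∀ y ∈ Metric.ball x r, y ∈ V ∧ F y = 0 := by
  -- a ball inside `V` on which `c ≤ c x + 1`
  have hev : ∀ᶠ y in 𝓝 x, y ∈ V ∧ c y < c x + 1 :=
    (hV.eventually_mem hx).and
      ((hc.continuousAt (hV.mem_nhds hx)).eventually_lt continuousAt_const (lt_add_one (c x)))
  obtain ⟨r, hr, hball⟩ := Metric.eventually_nhds_iff_ball.1 hev
  refine ⟨r, hr, fun y hy => ⟨(hball y hy).1, ?_⟩⟩
  -- the segment from `x` to `y` stays in the ball
  have hseg : ∀ t ∈ Icc (0 : ℝ) 1, x + t • (y - x) ∈ Metric.ball x r := by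
    intro t ht
    rw [Metric.mem_ball, dist_eq_norm, add_sub_cancel_left, norm_smul, Real.norm_eq_abs,
      abs_of_nonneg ht.1]
    calc t * ‖y - x‖ ≤ 1 * ‖y - x‖ := mul_le_mul_of_nonneg_right ht.2 (norm_nonneg _)
      _ = dist y x := by rw [one_mul, dist_eq_norm]
      _ < r := hy
  -- the composite `t ↦ F (x + t • (y - x))` and its derivative along the segment
  have hgd : ∀ t ∈ Icc (0 : ℝ) 1, HasDerivAt (fun s : ℝ => F (x + s • (y - x)))
      (fderiv ℝ F (x + t • (y - x)) (y - x)) t := by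
    intro t ht
    have hzV : x + t • (y - x) ∈ V := (hball _ (hseg t ht)).1
    have hγ : HasDerivAt (fun s : ℝ => x + s • (y - x)) (y - x) t := by
      simpa using ((hasDerivAt_id t).smul_const (y - x)).const_add x
    exact (hF.differentiableAt (hV.mem_nhds hzV)).hasFDerivAt.comp_hasDerivAt t hγ
  have hgc : ContinuousOn (fun s : ℝ => F (x + s • (y - x))) (Icc 0 1) := fun t ht =>
    (hgd t ht).continuousAt.continuousWithinAt
  -- the Grönwall bound `‖g'‖ ≤ (c x + 1) ‖y - x‖ ‖g‖`
  have hbound : ∀ t ∈ Ico (0 : ℝ) 1,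
      ‖fderiv ℝ F (x + t • (y - x)) (y - x)‖ ≤ (c x + 1) * ‖y - x‖ * ‖F (x + t • (y - x))‖ := by
    intro t ht
    have hz := hball _ (hseg t (Ico_subset_Icc_self ht))
    calc ‖fderiv ℝ F (x + t • (y - x)) (y - x)‖
        ≤ ‖fderiv ℝ F (x + t • (y - x))‖ * ‖y - x‖ := ContinuousLinearMap.le_opNorm _ _
      _ ≤ c (x + t • (y - x)) * ‖F (x + t • (y - x))‖ * ‖y - x‖ :=
        mul_le_mul_of_nonneg_right (hb _ hz.1) (norm_nonneg _)
      _ ≤ (c x + 1) * ‖F (x + t • (y - x))‖ * ‖y - x‖ :=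
        mul_le_mul_of_nonneg_right (mul_le_mul_of_nonneg_right hz.2.le (norm_nonneg _))
          (norm_nonneg _)
      _ = (c x + 1) * ‖y - x‖ * ‖F (x + t • (y - x))‖ := by ring
  have hg0 : (fun s : ℝ => F (x + s • (y - x))) 0 = 0 := by simp [hx0]
  -- Grönwall with zero initial value and zero forcing
  have hzero := eq_zero_of_abs_deriv_le_mul_abs_self_of_eq_zero_right
    (K := (c x + 1) * ‖y - x‖) (f' := fun t => fderiv ℝ F (x + t • (y - x)) (y - x)) hgc
    (fun t ht => (hgd t (Ico_subset_Icc_self ht)).hasDerivWithinAt) hg0 hbound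
  simpa using hzero 1 ⟨zero_le_one, le_rfl⟩

/-- **Stub (K-B) of wave 2 of the local unique continuation of Killing fields (crux `GapExhaustion`,
line `photon-shell-pseudoconvexity`)**: a map `F : E4 → W`, differentiable on an open connected set
`V`, whose derivative is pointwise dominated by a continuous multiple of its value,
`‖DF(x)‖ ≤ c(x) ‖F(x)‖` on `V`, and which vanishes at one point `x₀ ∈ V`, vanishes on `V`.
Grönwall along segments shows that the zero set is open; it is relatively closed by continuity;
connectedness concludes. -/
theorem stub_firstOrderVanishing :
    ∀ (W : Type) [NormedAddCommGroup W] [NormedSpace ℝ W] (V : Set E4) (F : E4 → W)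
      (c : E4 → ℝ) (x₀ : E4),
      IsOpen V → IsConnected V → DifferentiableOn ℝ F V → ContinuousOn c V →
      (∀ x ∈ V, ‖fderiv ℝ F x‖ ≤ c x * ‖F x‖) → x₀ ∈ V → F x₀ = 0 →
      ∀ x ∈ V, F x = 0 := by
  intro W _ _ V F c x₀ hV hVc hF hc hb hx₀ hF₀
  -- the zero set of `F` in `V` is open (Grönwall along segments) ...
  have hZ : IsOpen {x | x ∈ V ∧ F x = 0} :=
    Metric.isOpen_iff.2 fun x hx => firstOrderVanishing_ball hV hF hc hb hx.1 hx.2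
  -- ... and so is its complement in `V` (continuity of `F` on the open `V`)
  have hZ' : IsOpen (V ∩ F ⁻¹' {0}ᶜ) :=
    hF.continuousOn.isOpen_inter_preimage hV isOpen_compl_singleton
  -- connectedness of `V`
  have hsub : V ⊆ {x | x ∈ V ∧ F x = 0} :=
    hVc.isPreconnected.subset_left_of_subset_union hZ hZ'
      (Set.disjoint_left.2 fun x hx hx' => hx'.2 hx.2)
      (fun x hx => by
        by_cases h : F x = 0
        · exact Or.inl ⟨hx, h⟩
        · exact Or.inr ⟨hx, h⟩)
      ⟨x₀, hx₀, hx₀, hF₀⟩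
  intro x hx
  exact (hsub hx).2

end Summit.FinalStateConjecture.FinalStateConjecture.Theorems

end
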